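import Literature.MathematicalPhysics.QuantumFieldTheory.Balaban1983to89.B16RLeafRecord13LiveSLaw
import Summits.QuantumFields.YangMills.Theorems.BalabanUVNodesN11NoExpansionUnitBranch

/-!
# DAG node N11 — THE 𝐑-SIDE OF THE KERNEL HALF OF Q-W: at every live Stage-13 witness the rough-fibre ∕ Haar-null necessary conditions of seat dag-n11-d
# follow ALREADY from `SLaw₁₃ θ p 1` — the §2 form of `ρ₁` of record, i.e. N11's node CONCLUSION `densitiesDescribed` at its first level — not only from the
# (S1ᵀ) instance `TLaw₁₃ θ p 0`; hence from any non-vacuous `Dag.B14_main (leavesP w P)` at a world bound to the witness of record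

Cell `pub-ymgap`, YM-PLAN Track A (HUMAN RULING D-0062), seat `pub-ymgap-dag-n11-e` (g7; R134 N11 [B14], strategy s3 «𝐑-operation side»), item K1⁗ `StabilityBAtRecordR13Sep`
= stmt-QuantumFields-20290.  [III] = [Balaban1988Convergent], [IV] = [Balaban1989LargeFieldI], [B7] = [Balaban1985Averaging].  Composition of this seat's Literature module
`…B16RLeafRecord13LiveSLaw` (the CONVERSE reading of the live-line 𝐑-bookkeeping: `SLaw₁₃ θ p (k+1)` ⇒ the a.e. two-branch 𝐓-form of the pre-𝐑 family `slotT_{k+1}`;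
at a no-expansion `s′` the guard-free clause «`slotT =ᵐ 0 ∨ slotT =ᵐ 𝐓 exp A`») with seat dag-n11-d's kernel modules `Thm/BalabanUVNodesN11NoExpansionRoughFibre` (the
Φ-generic `transport_chiRegW_mul_ae_zero_on_rough`, [B7] Prop. 2 via seat dag-n21-c), `…N11AllLargeFieldLabel` and `…N11NoExpansionUnitBranch` (`…_of_slotsT_ae_zero` faces).

WHY THIS FILE.  Seat dag-n11-d's chain reads: `TLaw₁₃ θ p 0` ⇒ (clause at the all-large-field sequence `s′₀`, `Ω₁(s′₀) = ∅`) ⇒ `slotT_1(s′₀) = 0` a.e. on the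
rough coarse fields ⇒ (i) `avgDensity = 0` a.e. on the rough all-(3.2)-large coarse fields, (ii) `avgDensity·avgKernel(cube-rough) = 0` a.e. on the rough all-(3.2)-small
ones.  On the live-selector line (every K0-lane witness) 𝐑 of record is the identity up to null sets, so the §2 form of `ρ₁` (`SLaw₁₃ θ p 1`) forces the SAME clause
with an a.e. left branch (`…LiveSLaw` §1–§3), which is all the chain reads.  Hence (§1, any `θ`, clause-keyed so that BOTH sources feed it) `slotsT_one_ae_zero_on_rough_of_aeClause` — n11-d's
`slotsT_one_ae_zero_on_rough_of_tLaw₁₃` with the hypothesis `TLaw₁₃ θ p 0` replaced by the a.e. clause for a GIVEN pair `(t, E_1)` and the measurability ∕ bound of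
the no-expansion integrand of THAT operand displayed (NO junction, NO `M ≥ 1`: the regularity factor `χreg_0(𝐓) ∈ {0,1}` multiplies def-T's no-expansion integrand
whatever the operand, `Node00.noExpIntegrand_WtOfRecord₁₃_eq_zero_of_chiRegW_eq_zero`); (§2) its discharge at `θ.Zt = ZtOfRecord` under the junction and `M ≥ 1`
(n11-d's `noExpIntegrand_termFree_of_Zt_eq_ZtOfRecord`, `measurable_chiRegW_pairCfg_mul`, `abs_chiRegW_pairCfg_mul_rhoZero_le`) and ★ `slotsT_one_ae_zero_on_rough_of_sLaw₁₃_one_of_liveSel`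
(any `θ` at the live selector carrying K0b's residuals: `SLaw₁₃ θ p 1` ⇒ `slotT_1(s′₀) = 0` a.e. on the rough coarse fields); (§3) ★★ AT K0a's WITNESS OF RECORD
`theta13LiveOfRecord`: `SLaw₁₃ θ₁₃ p 1` ⇒ the rough-fibre vanishing, (i) and (ii) — hypotheses `0 ≤ g₀`, `0 < K`, the [B7] guards on `α₀` with `ε₀(g₀) ≤ α₀η₁²`,
and `SLaw₁₃ θ₁₃ p 1` ONLY; (§4) ★★ the NODE faces at a world bound to the v1.2 datum of the witness of record: `densitiesDescribed (leavesP w p)` ⇒ (i) ∧ (ii), and a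
`Dag.B14_main (leavesP w p)` whose in-edge leaves, small-field implication, flow control and interval hypothesis read TRUE ⇒ (i) ∧ (ii) (the `rOperation` antecedent is
this seat's closed theorem `…LiveRstep.rOperation_leavesP_theta13LiveOfRecord`); (§5) ★★ the UNIT-BRANCH face at the live selector with `εreg` in [B7] Prop. 2's
range (n11-d's `fieldMeasure_cubeRough_inter_preimage_eq_zero_of_slotsT_ae_zero` fed by §2): `SLaw₁₃ θ p 1` ⇒ `dU{U ∈ R, Ū cornered-cube-rough} = 0` — the event whose
Haar-POSITIVITY is n11-d's announced next file.  READING: K1⁗'s rung-1 conjunct `Dag.B14_main (leavesP w P)` at the K0-lane witnesses is hostage to exactly the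
kernel fact n11-d isolated — whichever way one reaches it; no 𝐑 of record on that line supplies §2 form the 𝐓-image lacks.

HONEST FRAMING.  Count-neutral kernel bookkeeping on the tree's OWN objects; necessary conditions of the typed §2 form of `ρ₁` at live witnesses; nothing of
Bałaban's asserted or refuted (the located defect is the tree's split into def-T's `w` and 12a's `Zt`·`χreg`, lit-balaban DESK-ANSWER ME #15); N11 ∕ K1⁗ NOT
discharged ∕ refuted; counts unmoved.  One finite four-torus at fixed `ε = L^{−K}`; NOT ℝ⁴ ∕ OS ∕ mass gap ∕ Clay.  Sources: [III] Theorem p.245, Thm 1 p.262, (2.10)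
p.256, (2.17)–(2.18) p.257, (2.21)–(2.23) p.258, (3.1)–(3.5) pp.264–265, (3.16) p.268, (3.24)–(3.25) p.270; [IV] (0.3)–(0.4) p.176; [B7] (10) p.19, Prop. 2 (53) p.26.
-/

noncomputable section

open MeasureTheory ProbabilityTheory
open scoped BigOperators Matrix.Norms.L2Operator ENNReal NNReal

namespace Summit.QuantumFields.YangMills.Theorems.BalabanUVNodesN11LiveRecordRoughFibre

open Literature.MathematicalPhysics.QuantumFieldTheory.Balaban1983to89 T4Continuum Node00 Node00.Tk DagBinding
open Literature.MathematicalPhysics.QuantumFieldTheory.Balaban1983to89.T4AveragingDisintegration (avgKernel avgDensity)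
open Literature.MathematicalPhysics.QuantumFieldTheory.Balaban1983to89.ExpMeanLog (deltaSU)
open Literature.MathematicalPhysics.QuantumFieldTheory.Balaban1983to89.B16RLeafRecord13LiveRstep (rOperation_leavesP_theta13LiveOfRecord)
open Literature.MathematicalPhysics.QuantumFieldTheory.Balaban1983to89.B16RLeafRecord13LiveSLaw
open GaugeField (plaqHol)
open Summit.QuantumFields.YangMills.Theorems.BalabanUVNodesN11NoExpansionTermFree
  (noExpIntegrand_termFree_of_Zt_eq_ZtOfRecord measurable_chiRegW_pairCfg_mul abs_chiRegW_pairCfg_mul_rhoZero_le one_le_M_theta13LiveOfFamily)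
open Summit.QuantumFields.YangMills.Theorems.BalabanUVNodesN11NoExpansionRoughFibre (transport_chiRegW_mul_ae_zero_on_rough)
open Summit.QuantumFields.YangMills.Theorems.BalabanUVNodesN11AllLargeFieldLabel
  (avgDensity_ae_zero_on_allLarge_of_slotsT_ae_zero avgDensity_zero_or_avgKernel_zero_ae_on_allSmall_of_slotsT_ae_zero sideD_pos sideχ_pos)
open Summit.QuantumFields.YangMills.Theorems.BalabanUVNodesN11NoExpansionUnitBranch (fieldMeasure_cubeRough_inter_preimage_eq_zero_of_slotsT_ae_zero)
open B14.Eq213MaximalDomains (side)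
open B15DeterminingSets (pts)

variable {F : T4Family} {N : ℕ} [NeZero N]

/-! ## §1. CLAUSE-KEYED, any `θ`: the a.e. clause at a no-expansion sequence for a GIVEN operand ⇒ the pre-𝐑 slot vanishes a.e. on the rough coarse fields -/

section Clause

variable (θ : Stage13Params F N) (p : B12.RunParams)

/-- **THE NO-EXPANSION INTEGRAND IS ITS OWN `χreg_0(𝐓)`-CUT** (pointwise, any operand, any `θ`): p. 256's regularity factor at the two-scale configuration is
`0` or `1` (`Node00.chiRegW_zero_pairCfg`) and def-T's integrand vanishes where it is `0` (`Node00.noExpIntegrand_WtOfRecord₁₃_eq_zero_of_chiRegW_eq_zero`).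
[cite: Balaban1988Convergent, (2.10) p.256, (2.21) p.258 (bookkeeping)] -/
theorem noExpIntegrand_eq_chiRegW_mul (Φ : SFluct (F.P p.K) (FluctV N) → B15DeterminingSets.MSField (F.P p.K) (SU N) → ℝ)
    (V1 : GaugeField (F.P p.K) 1 (SU N)) (Uf : GaugeField (F.P p.K) 0 (SU N)) :
    noExpIntegrand F N (FluctV N) p.K (WtOfRecord₁₃ F N θ p) Φ V1 Uf =
      chiRegW F N (FluctV N) θ.ν θ.s2.cR p (gOfRecord₁₃ F N θ p) 0 Set.univ (pairCfg (V := FluctV N) V1 Uf) *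
        noExpIntegrand F N (FluctV N) p.K (WtOfRecord₁₃ F N θ p) Φ V1 Uf := by
  by_cases h : chiRegW F N (FluctV N) θ.ν θ.s2.cR p (gOfRecord₁₃ F N θ p) 0 Set.univ (pairCfg (V := FluctV N) V1 Uf) = 0
  · rw [h, zero_mul, noExpIntegrand_WtOfRecord₁₃_eq_zero_of_chiRegW_eq_zero θ p Φ V1 Uf h]
  · have h1 : chiRegW F N (FluctV N) θ.ν θ.s2.cR p (gOfRecord₁₃ F N θ p) 0 Set.univ (pairCfg (V := FluctV N) V1 Uf) = 1 := by
      rw [chiRegW_zero_pairCfg] at h ⊢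
      split_ifs with hs
      · rfl
      · exact absurd (if_neg hs) h
    rw [h1, one_mul]

/-- **★ CLAUSE-KEYED ROUGH-FIBRE VANISHING, ANY `θ`** (seat dag-n11-d's `…RoughFibre.slotsT_one_ae_zero_on_rough_of_tLaw₁₃` with `TLaw₁₃ θ p 0` replaced by the a.e.
clause for a GIVEN `(t, E_1)` — left branch almost everywhere — and the measurability ∕ bound of the no-expansion integrand of THAT operand displayed; `0 < K`, the
[B7] guards on `α₀`, `cR·ε₀ ≤ α₀η₁²`; NO junction, NO `M ≥ 1`): at a new sequence `s′` with `Ω₁(s′) = ∅`, if `slotT_1(s′) =ᵐ 0` or `slotT_1(s′) =ᵐ 𝐓_1(s′) exp A_1(s′)`,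
then `slotT_1(s′)(V₁) = 0` for `dV₁`-a.e. `V₁` with `¬PlaqSmall (2α₀(Lη₁)²) V₁` — the right branch is def-T's transport of a `χreg_0(𝐓)`-cut integrand
(`Node00.sect2Slot_one_ae_eq_transport_of_Omega_empty₁₃`, `noExpIntegrand_eq_chiRegW_mul`), killed over rough averages by n11-d's `transport_chiRegW_mul_ae_zero_on_rough`.
[cite: Balaban1988Convergent, Theorem p.245, (3.1) p.264, (3.25) p.270, (2.10) p.256, (2.21) p.258; Balaban1985Averaging, Prop. 2 (53) p.26] -/
theorem slotsT_one_ae_zero_on_rough_of_aeClause (hK : 0 < p.K)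
    (s : SeqOfRecord F θ.ν θ.τ9.M (gOfRecord₁₃ F N θ p) p.K 1) (hΩ : s.Ω 1 = ∅)
    (t : Sect2.TermValues (F.P p.K) (MatA N) (FluctV N) θ.τ9.M) (Ek : ℝ)
    (hcl : (slotsTOfRecord F N θ.ν θ.τ9 (EOfRecord₁₃ F N θ) (wOfRecord₉ F N θ.toStage9Params) θ.ppSel p
          (gOfRecord₁₃ F N θ p) 1 s =ᵐ[fieldMeasure (F.P p.K) 1 (SU N)] 0) ∨
        ∀ᵐ V1 ∂fieldMeasure (F.P p.K) 1 (SU N),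
          slotsTOfRecord F N θ.ν θ.τ9 (EOfRecord₁₃ F N θ) (wOfRecord₉ F N θ.toStage9Params) θ.ppSel p
              (gOfRecord₁₃ F N θ p) 1 s V1 =
            sect2Slot F N (FluctV N) p.K (settingOfRecord₁₃ F N θ p) (θ.Rz p.K) (WtOfRecord₁₃ F N θ p) s t Ek
              (UbgOfRecord₁₃ F N θ p 1 s) V1)
    {α₀ : ℝ} (hα : 0 < α₀)
    (hα3 : (143 * (((((F.P p.K).d + 4 : ℕ) : ℝ)) ^ 2 / 4) ^ 2) * α₀ ≤ 1 / 3)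
    (hα2 : 2 * α₀ ≤ 2 * deltaSU (Fin N) / ((((F.P p.K).d + 4) * (F.P p.K).L : ℕ) : ℝ) ^ 2)
    (hαε : θ.s2.cR * epsOfRecord θ.ν (gOfRecord₁₃ F N θ p) 0 ≤ α₀ * (F.P p.K).eta 1 ^ 2)
    {C : ℝ}
    (hm : Measurable (Function.uncurry (noExpIntegrand F N (FluctV N) p.K (WtOfRecord₁₃ F N θ p)
      (sect2Operand F N (FluctV N) p.K (settingOfRecord₁₃ F N θ p) (θ.Rz p.K) s t Ek (UbgOfRecord₁₃ F N θ p 1 s)))))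
    (hC : ∀ V1 Uf, |noExpIntegrand F N (FluctV N) p.K (WtOfRecord₁₃ F N θ p)
      (sect2Operand F N (FluctV N) p.K (settingOfRecord₁₃ F N θ p) (θ.Rz p.K) s t Ek (UbgOfRecord₁₃ F N θ p 1 s)) V1 Uf| ≤ C) :
    ∀ᵐ V1 ∂fieldMeasure (F.P p.K) 1 (SU N), ¬ PlaqSmall (2 * α₀ * (((F.P p.K).L : ℝ) ^ 1 * (F.P p.K).eta 1) ^ 2) V1 →
      slotsTOfRecord F N θ.ν θ.τ9 (EOfRecord₁₃ F N θ) (wOfRecord₉ F N θ.toStage9Params) θ.ppSel p (gOfRecord₁₃ F N θ p) 1 s V1 = 0 := by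
  rcases hcl with h0 | hid
  · filter_upwards [h0] with V1 hV1 _
    exact hV1
  · have h2 := sect2Slot_one_ae_eq_transport_of_Omega_empty₁₃ θ p hK s hΩ t Ek (UbgOfRecord₁₃ F N θ p 1 s) hm hC
    have hR := transport_chiRegW_mul_ae_zero_on_rough θ p hK hα hα3 hα2 hαε
      (noExpIntegrand F N (FluctV N) p.K (WtOfRecord₁₃ F N θ p)
        (sect2Operand F N (FluctV N) p.K (settingOfRecord₁₃ F N θ p) (θ.Rz p.K) s t Ek (UbgOfRecord₁₃ F N θ p 1 s)))
    filter_upwards [hid, h2, hR] with V1 hV1 hV2 hR1 hrough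
    rw [hV1, hV2, ← hR1 hrough]
    congr 1
    funext Uf
    exact noExpIntegrand_eq_chiRegW_mul θ p _ V1 Uf

end Clause

/-! ## §2. AT `θ.Zt = ZtOfRecord` the displayed measurability ∕ bound are discharged; at the live selector `SLaw₁₃ θ p 1` supplies the clause -/

section ZtOfRecord

variable (θ : Stage13Params F N) (p : B12.RunParams)

/-- **CLAUSE-KEYED ROUGH-FIBRE VANISHING AT A `θ` WITH `θ.Zt = ZtOfRecord`** (junction, `M ≥ 1`, `0 < K`, guards; the measurability ∕ bound of §1 discharged by seat
dag-n11-d's term-free closed form `noExpIntegrand_termFree_of_Zt_eq_ZtOfRecord`: `(#{Y})⁻¹·χreg_0(𝐓)·e^{E−E_1}·ρ₀`). [cite: Balaban1988Convergent, Theorem p.245, (3.1) p.264, (3.25) p.270, (2.10) p.256, (2.21)–(2.23) p.258, (3.16) p.268; Balaban1985Averaging, Prop. 2 (53) p.26] -/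
theorem slotsT_one_ae_zero_on_rough_of_aeClause_of_Zt_eq_ZtOfRecord (hZt : θ.Zt = ZtOfRecord F N)
    (hc : θ.s2.cR * epsOfRecord θ.ν (gOfRecord₁₃ F N θ p) 0 ≤ θ.ν.εreg * (F.P p.K).eta 0 ^ 2) (hM : 1 ≤ θ.τ9.M) (hK : 0 < p.K)
    (s : SeqOfRecord F θ.ν θ.τ9.M (gOfRecord₁₃ F N θ p) p.K 1) (hΩ : s.Ω 1 = ∅)
    (t : Sect2.TermValues (F.P p.K) (MatA N) (FluctV N) θ.τ9.M) (Ek : ℝ)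
    (hcl : (slotsTOfRecord F N θ.ν θ.τ9 (EOfRecord₁₃ F N θ) (wOfRecord₉ F N θ.toStage9Params) θ.ppSel p
          (gOfRecord₁₃ F N θ p) 1 s =ᵐ[fieldMeasure (F.P p.K) 1 (SU N)] 0) ∨
        ∀ᵐ V1 ∂fieldMeasure (F.P p.K) 1 (SU N),
          slotsTOfRecord F N θ.ν θ.τ9 (EOfRecord₁₃ F N θ) (wOfRecord₉ F N θ.toStage9Params) θ.ppSel p
              (gOfRecord₁₃ F N θ p) 1 s V1 =
            sect2Slot F N (FluctV N) p.K (settingOfRecord₁₃ F N θ p) (θ.Rz p.K) (WtOfRecord₁₃ F N θ p) s t Ek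
              (UbgOfRecord₁₃ F N θ p 1 s) V1)
    {α₀ : ℝ} (hα : 0 < α₀)
    (hα3 : (143 * (((((F.P p.K).d + 4 : ℕ) : ℝ)) ^ 2 / 4) ^ 2) * α₀ ≤ 1 / 3)
    (hα2 : 2 * α₀ ≤ 2 * deltaSU (Fin N) / ((((F.P p.K).d + 4) * (F.P p.K).L : ℕ) : ℝ) ^ 2)
    (hαε : θ.s2.cR * epsOfRecord θ.ν (gOfRecord₁₃ F N θ p) 0 ≤ α₀ * (F.P p.K).eta 1 ^ 2) :
    ∀ᵐ V1 ∂fieldMeasure (F.P p.K) 1 (SU N), ¬ PlaqSmall (2 * α₀ * (((F.P p.K).L : ℝ) ^ 1 * (F.P p.K).eta 1) ^ 2) V1 →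
      slotsTOfRecord F N θ.ν θ.τ9 (EOfRecord₁₃ F N θ) (wOfRecord₉ F N θ.toStage9Params) θ.ppSel p (gOfRecord₁₃ F N θ p) 1 s V1 = 0 := by
  -- the constant in front of `χreg·ρ₀` in the term-free integrand
  set c : ℝ := ((Nat.card (Set (Site (F.P p.K) 0)) : ℝ))⁻¹ * Real.exp (EOfRecord₁₃ F N θ p - Ek) with hc_def
  have hI : noExpIntegrand F N (FluctV N) p.K (WtOfRecord₁₃ F N θ p)
      (sect2Operand F N (FluctV N) p.K (settingOfRecord₁₃ F N θ p) (θ.Rz p.K) s t Ek (UbgOfRecord₁₃ F N θ p 1 s)) =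
      fun (V1 : GaugeField (F.P p.K) 1 (SU N)) (Uf : GaugeField (F.P p.K) 0 (SU N)) =>
        c * (chiRegW F N (FluctV N) θ.ν θ.s2.cR p (gOfRecord₁₃ F N θ p) 0 Set.univ (pairCfg (V := FluctV N) V1 Uf) *
          rhoZeroOfRecord F N p.K p.g0 (EOfRecord₁₃ F N θ p) Uf) := by
    funext V1 Uf
    rw [noExpIntegrand_termFree_of_Zt_eq_ZtOfRecord θ p hZt hc hM s hΩ t Ek V1 Uf, hc_def]
    ring
  have hm0 := measurable_chiRegW_pairCfg_mul θ p (measurable_rhoZeroOfRecord F N p.K p.g0 (EOfRecord₁₃ F N θ p))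
  have hm : Measurable (Function.uncurry (noExpIntegrand F N (FluctV N) p.K (WtOfRecord₁₃ F N θ p)
      (sect2Operand F N (FluctV N) p.K (settingOfRecord₁₃ F N θ p) (θ.Rz p.K) s t Ek (UbgOfRecord₁₃ F N θ p 1 s)))) := by
    rw [hI]
    exact hm0.const_mul c
  have hC : ∀ (V1 : GaugeField (F.P p.K) 1 (SU N)) (Uf : GaugeField (F.P p.K) 0 (SU N)),
      |noExpIntegrand F N (FluctV N) p.K (WtOfRecord₁₃ F N θ p)
        (sect2Operand F N (FluctV N) p.K (settingOfRecord₁₃ F N θ p) (θ.Rz p.K) s t Ek (UbgOfRecord₁₃ F N θ p 1 s)) V1 Uf| ≤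
        |c| * Real.exp (-EOfRecord₁₃ F N θ p) := by
    intro V1 Uf
    rw [hI, abs_mul]
    exact mul_le_mul_of_nonneg_left (abs_chiRegW_pairCfg_mul_rhoZero_le θ p _ V1 Uf) (abs_nonneg _)
  exact slotsT_one_ae_zero_on_rough_of_aeClause θ p hK s hΩ t Ek hcl hα hα3 hα2 hαε hm hC

/-- **★ AT THE LIVE SELECTOR OF A `θ` CARRYING K0b's RESIDUALS, `SLaw₁₃ θ p 1` FORCES def-T's ALL-LARGE-FIELD PRE-𝐑 SLOT TO VANISH ON THE ROUGH COARSE FIELDS**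
(junction, `M ≥ 1`, `0 < K`, guards; the clause is this seat's `…LiveSLaw.sLaw₁₃_succ_clause_of_Omega_empty_of_liveSel_of_hasResiduals`, `θ.Zt = ZtOfRecord` is a
field of `HasResidualsOfRecord`): for the all-large-field new sequence `s′₀` (`Ω₁(s′₀) = ∅`), `slotT_1(s′₀)(V₁) = 0` for `dV₁`-a.e. `V₁` with `¬PlaqSmall (2α₀(Lη₁)²) V₁`.
The §2 form of `ρ₁` of record — not the (S1ᵀ) instance — is the hypothesis. [cite: Balaban1988Convergent, Thm 1 p.262, (2.17)–(2.18) p.257, (3.1) p.264, (3.24)–(3.25) p.270, (2.10) p.256, (3.16) p.268; Balaban1989LargeFieldI, (0.3)–(0.4) p.176; Balaban1985Averaging, Prop. 2 (53) p.26] -/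
theorem slotsT_one_ae_zero_on_rough_of_sLaw₁₃_one_of_liveSel (hres : θ.HasResidualsOfRecord F N)
    (hsel : θ.ppSel = ppSelLiveOfRecord F N θ.ν θ.τ9 (EOfRecord₁₃ F N θ) (wOfRecord₉ F N θ.toStage9Params))
    (hc : θ.s2.cR * epsOfRecord θ.ν (gOfRecord₁₃ F N θ p) 0 ≤ θ.ν.εreg * (F.P p.K).eta 0 ^ 2) (hM : 1 ≤ θ.τ9.M) (hK : 0 < p.K)
    (s : SeqOfRecord F θ.ν θ.τ9.M (gOfRecord₁₃ F N θ p) p.K 1) (hΩ : s.Ω 1 = ∅) (hS : SLaw₁₃ F N θ p 1) {α₀ : ℝ} (hα : 0 < α₀)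
    (hα3 : (143 * (((((F.P p.K).d + 4 : ℕ) : ℝ)) ^ 2 / 4) ^ 2) * α₀ ≤ 1 / 3)
    (hα2 : 2 * α₀ ≤ 2 * deltaSU (Fin N) / ((((F.P p.K).d + 4) * (F.P p.K).L : ℕ) : ℝ) ^ 2)
    (hαε : θ.s2.cR * epsOfRecord θ.ν (gOfRecord₁₃ F N θ p) 0 ≤ α₀ * (F.P p.K).eta 1 ^ 2) :
    ∀ᵐ V1 ∂fieldMeasure (F.P p.K) 1 (SU N), ¬ PlaqSmall (2 * α₀ * (((F.P p.K).L : ℝ) ^ 1 * (F.P p.K).eta 1) ^ 2) V1 →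
      slotsTOfRecord F N θ.ν θ.τ9 (EOfRecord₁₃ F N θ) (wOfRecord₉ F N θ.toStage9Params) θ.ppSel p (gOfRecord₁₃ F N θ p) 1 s V1 = 0 := by
  obtain ⟨t, Ek, -, -, hcl⟩ :=
    sLaw₁₃_succ_clause_of_Omega_empty_of_liveSel_of_hasResiduals F N θ p hres hsel (k := 0) hK hS s hΩ
  exact slotsT_one_ae_zero_on_rough_of_aeClause_of_Zt_eq_ZtOfRecord θ p hres.Zt_eq hc hM hK s hΩ (t s) (Ek s) hcl hα hα3 hα2 hαε

end ZtOfRecord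

/-! ## §3. AT K0a's WITNESS OF RECORD `theta13LiveOfRecord`: `SLaw₁₃ θ₁₃ p 1` ⇒ the rough-fibre vanishing and n11-d's two Haar-null readings -/

section AtRecord

variable (F N)

/-- **★★ AT K0a's WITNESS OF RECORD, THE §2 FORM OF `ρ₁` FORCES def-T's ALL-LARGE-FIELD PRE-𝐑 SLOT TO VANISH ON THE ROUGH COARSE FIELDS** (`Zt := ZtOfRecord`,
`cR = εreg = 1`, `τ9.M = 1`, the live selector of record): on every run with `0 ≤ g₀`, `0 < K`, `SLaw₁₃ θ₁₃ p 1` ⇒ `slotT_1(s′₀)(V₁) = 0` for a.e. coarse field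
`V₁` that is not `2α₀`-plaquette-small (`ε₀(g₀) ≤ α₀η₁²`, [B7] guards on `α₀`) — seat dag-n11-d's `slotsT_one_ae_zero_on_rough_theta13LiveOfRecord` with `SLaw₁₃ θ₁₃ p 1`
for `TLaw₁₃ θ₁₃ p 0`. [cite: Balaban1988Convergent, Thm 1 p.262, (2.18) p.257, (3.25) p.270, (2.10) p.256, (3.16) p.268, (3.22) p.269; Balaban1989LargeFieldI, (0.3)–(0.4) p.176; Balaban1985Averaging, Prop. 2 (53) p.26] -/
theorem slotsT_one_ae_zero_on_rough_of_sLaw₁₃_one_theta13LiveOfRecord (p : B12.RunParams) (hg : 0 ≤ p.g0) (hK : 0 < p.K)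
    (s : SeqOfRecord F (theta13LiveOfRecord F N).ν (theta13LiveOfRecord F N).τ9.M (gOfRecord₁₃ F N (theta13LiveOfRecord F N) p) p.K 1)
    (hΩ : s.Ω 1 = ∅) (hS : SLaw₁₃ F N (theta13LiveOfRecord F N) p 1) {α₀ : ℝ} (hα : 0 < α₀)
    (hα3 : (143 * (((((F.P p.K).d + 4 : ℕ) : ℝ)) ^ 2 / 4) ^ 2) * α₀ ≤ 1 / 3)
    (hα2 : 2 * α₀ ≤ 2 * deltaSU (Fin N) / ((((F.P p.K).d + 4) * (F.P p.K).L : ℕ) : ℝ) ^ 2)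
    (hαε : (theta13LiveOfRecord F N).s2.cR * epsOfRecord (theta13LiveOfRecord F N).ν (gOfRecord₁₃ F N (theta13LiveOfRecord F N) p) 0 ≤
      α₀ * (F.P p.K).eta 1 ^ 2) :
    ∀ᵐ V1 ∂fieldMeasure (F.P p.K) 1 (SU N), ¬ PlaqSmall (2 * α₀ * (((F.P p.K).L : ℝ) ^ 1 * (F.P p.K).eta 1) ^ 2) V1 →
      slotsTOfRecord F N (theta13LiveOfRecord F N).ν (theta13LiveOfRecord F N).τ9 (EOfRecord₁₃ F N (theta13LiveOfRecord F N))
        (wOfRecord₉ F N (theta13LiveOfRecord F N).toStage9Params) (theta13LiveOfRecord F N).ppSel p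
        (gOfRecord₁₃ F N (theta13LiveOfRecord F N) p) 1 s V1 = 0 := by
  obtain ⟨t, Ek, -, -, hcl⟩ := sLaw₁₃_succ_clause_of_Omega_empty_theta13LiveOfRecord F N p (k := 0) hK hS s hΩ
  exact slotsT_one_ae_zero_on_rough_of_aeClause_of_Zt_eq_ZtOfRecord _ p (Zt_theta13LiveOfFamily F N eps0OfRecord₁₃ _ _ (ZtOfRecord F N))
    (lettersJunction_theta13LiveOfRecord F N p hg) (one_le_M_theta13LiveOfFamily F N eps0OfRecord₁₃ _ _ (ZtOfRecord F N)) hK s hΩ (t s) (Ek s) hcl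
    hα hα3 hα2 hαε

/-- **★★ AT K0a's WITNESS OF RECORD, THE ROUGH ALL-(3.2)-LARGE COARSE FIELDS CARRY NO AVERAGED MASS if `ρ₁` of record has the §2 form**: on every run with
`0 ≤ g₀`, `0 < K`, `SLaw₁₃ θ₁₃ p 1` ⇒ `avgDensity(V₁) = 0` for a.e. `V₁` not `2α₀`-plaquette-small with every χ₁-cube (3.2)-large — seat dag-n11-d's
`avgDensity_ae_zero_on_rough_allLarge_theta13LiveOfRecord` with `SLaw₁₃ θ₁₃ p 1` for `TLaw₁₃ θ₁₃ p 0` (their `…_of_slotsT_ae_zero` face, by name).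
[cite: Balaban1988Convergent, Thm 1 p.262, (2.18) p.257, (3.25) p.270, (3.2) p.265, (2.12) p.256; Balaban1985Averaging, Prop. 2 (53) p.26, (10) p.19] -/
theorem avgDensity_ae_zero_on_rough_allLarge_of_sLaw₁₃_one_theta13LiveOfRecord (p : B12.RunParams) (hg : 0 ≤ p.g0) (hK : 0 < p.K)
    (s : SeqOfRecord F (theta13LiveOfRecord F N).ν (theta13LiveOfRecord F N).τ9.M (gOfRecord₁₃ F N (theta13LiveOfRecord F N) p) p.K 1)
    (hΩ : s.Ω 1 = ∅) (hS : SLaw₁₃ F N (theta13LiveOfRecord F N) p 1) {α₀ : ℝ} (hα : 0 < α₀)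
    (hα3 : (143 * (((((F.P p.K).d + 4 : ℕ) : ℝ)) ^ 2 / 4) ^ 2) * α₀ ≤ 1 / 3)
    (hα2 : 2 * α₀ ≤ 2 * deltaSU (Fin N) / ((((F.P p.K).d + 4) * (F.P p.K).L : ℕ) : ℝ) ^ 2)
    (hαε : (theta13LiveOfRecord F N).s2.cR * epsOfRecord (theta13LiveOfRecord F N).ν (gOfRecord₁₃ F N (theta13LiveOfRecord F N) p) 0 ≤
      α₀ * (F.P p.K).eta 1 ^ 2) :
    ∀ᵐ V1 ∂fieldMeasure (F.P p.K) 1 (SU N), ¬ PlaqSmall (2 * α₀ * (((F.P p.K).L : ℝ) ^ 1 * (F.P p.K).eta 1) ^ 2) V1 →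
      (∀ c : Iχ F (theta13LiveOfRecord F N).ν p (gOfRecord₁₃ F N (theta13LiveOfRecord F N) p) 0,
        chiFactor F N (theta13LiveOfRecord F N).ν p (gOfRecord₁₃ F N (theta13LiveOfRecord F N) p) 0 c V1 = 0) →
        (avgDensity (avOfRecord F N p.K 0).avg V1 : ℝ) = 0 :=
  avgDensity_ae_zero_on_allLarge_of_slotsT_ae_zero _ p (hasResidualsOfRecord_theta13LiveOfRecord F N).zetaUnity
    (sideD_pos _ (one_le_M_theta13LiveOfFamily F N eps0OfRecord₁₃ _ _ (ZtOfRecord F N)) p _ 0) (sideχ_pos Nat.one_pos p _ 0) s hΩ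
    (slotsT_one_ae_zero_on_rough_of_sLaw₁₃_one_theta13LiveOfRecord F N p hg hK s hΩ hS hα hα3 hα2 hαε)

/-- **★★ AT K0a's WITNESS OF RECORD, THE ROUGH ALL-(3.2)-SMALL COARSE FIELDS CARRY NO CUBE-ROUGH FINE FIELD ON THEIR FIBRES if `ρ₁` of record has the §2 form**:
`SLaw₁₃ θ₁₃ p 1` ⇒ `avgDensity(V₁) = 0 ∨ avgKernel(V₁)(R) = 0` for a.e. `V₁` not `2α₀`-plaquette-small with every χ₁-cube (3.2)-small, for every measurable set `R` of
cube-rough old fields (`0 ≤ g₀`, `0 < K`, guards) — seat dag-n11-d's `avgDensity_zero_or_avgKernel_cubeRough_zero_ae_theta13LiveOfRecord` with `SLaw₁₃ θ₁₃ p 1` for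
`TLaw₁₃ θ₁₃ p 0`. [cite: Balaban1988Convergent, Thm 1 p.262, (2.18) p.257, (3.25) p.270, (3.2)–(3.3) p.265, (2.12) p.256; Balaban1985Averaging, Prop. 2 (53) p.26, (10) p.19] -/
theorem avgDensity_zero_or_avgKernel_cubeRough_zero_ae_of_sLaw₁₃_one_theta13LiveOfRecord (p : B12.RunParams) (hg : 0 ≤ p.g0) (hK : 0 < p.K)
    (s : SeqOfRecord F (theta13LiveOfRecord F N).ν (theta13LiveOfRecord F N).τ9.M (gOfRecord₁₃ F N (theta13LiveOfRecord F N) p) p.K 1)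
    (hΩ : s.Ω 1 = ∅) (hS : SLaw₁₃ F N (theta13LiveOfRecord F N) p 1) {α₀ : ℝ} (hα : 0 < α₀)
    (hα3 : (143 * (((((F.P p.K).d + 4 : ℕ) : ℝ)) ^ 2 / 4) ^ 2) * α₀ ≤ 1 / 3)
    (hα2 : 2 * α₀ ≤ 2 * deltaSU (Fin N) / ((((F.P p.K).d + 4) * (F.P p.K).L : ℕ) : ℝ) ^ 2)
    (hαε : (theta13LiveOfRecord F N).s2.cR * epsOfRecord (theta13LiveOfRecord F N).ν (gOfRecord₁₃ F N (theta13LiveOfRecord F N) p) 0 ≤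
      α₀ * (F.P p.K).eta 1 ^ 2)
    {R : Set (GaugeField (F.P p.K) 0 (SU N))} (hRm : MeasurableSet R)
    (hR : ∀ U ∈ R, ∀ c : Iχ F (theta13LiveOfRecord F N).ν p (gOfRecord₁₃ F N (theta13LiveOfRecord F N) p) 0,
      ∃ q ∈ plaqInside (cubeEnl (F.P p.K) (sideχ F (theta13LiveOfRecord F N).ν p (gOfRecord₁₃ F N (theta13LiveOfRecord F N) p) 0) c 1),
        epsOfRecord (theta13LiveOfRecord F N).ν (gOfRecord₁₃ F N (theta13LiveOfRecord F N) p) 1 * (F.P p.K).eta 1 ^ 2 +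
            4 * (2 * deltaOfRecord (theta13LiveOfRecord F N).ν (gOfRecord₁₃ F N (theta13LiveOfRecord F N) p) 0 (theta13LiveOfRecord F N).A₁) ≤
          dist1 (plaqHol U q)) :
    ∀ᵐ V1 ∂fieldMeasure (F.P p.K) 1 (SU N), ¬ PlaqSmall (2 * α₀ * (((F.P p.K).L : ℝ) ^ 1 * (F.P p.K).eta 1) ^ 2) V1 →
      (∀ c : Iχ F (theta13LiveOfRecord F N).ν p (gOfRecord₁₃ F N (theta13LiveOfRecord F N) p) 0,
        chiFactor F N (theta13LiveOfRecord F N).ν p (gOfRecord₁₃ F N (theta13LiveOfRecord F N) p) 0 c V1 = 1) →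
        (avgDensity (avOfRecord F N p.K 0).avg V1 : ℝ) = 0 ∨ avgKernel (avOfRecord F N p.K 0).avg V1 R = 0 :=
  avgDensity_zero_or_avgKernel_zero_ae_on_allSmall_of_slotsT_ae_zero _ p (hasResidualsOfRecord_theta13LiveOfRecord F N).zetaUnity
    (sideD_pos _ (one_le_M_theta13LiveOfFamily F N eps0OfRecord₁₃ _ _ (ZtOfRecord F N)) p _ 0) (sideχ_pos Nat.one_pos p _ 0) s hΩ hRm hR
    (slotsT_one_ae_zero_on_rough_of_sLaw₁₃_one_theta13LiveOfRecord F N p hg hK s hΩ hS hα hα3 hα2 hαε)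

end AtRecord

/-! ## §4. THE NODE FACES at a world bound to the v1.2 datum of the witness of record: `densitiesDescribed` ∕ non-vacuous `Dag.B14_main` ⇒ the rough-fibre vanishing -/

section NodeFaces

variable (F N)
variable (p : B12.RunParams) (w : WorldP) (h : (theta13LiveOfRecord F N).Provisos₁₃Sep F N)

/-- **★★ N11's NODE CONCLUSION AT A WORLD BOUND TO THE v1.2 DATUM OF THE WITNESS OF RECORD FORCES THE ROUGH-FIBRE VANISHING** (`K0⁗`'s own datum binder
`h : Provisos₁₃Sep θ₁₃`; `0 ≤ g₀`, `0 < K`, guards): `densitiesDescribed (leavesP w p)` ⇒ def-T's all-large-field pre-𝐑 slot vanishes for a.e. rough coarse field —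
through `SLaw₁₃ θ₁₃ p 1` (`…LiveSLaw.densitiesDescribed_leavesP_iff_sLaw₁₃_all_sep`). [cite: Balaban1988Convergent, Thm 1 p.262, (2.18) p.257, (3.25) p.270, (2.10) p.256, (3.16) p.268; Balaban1989LargeFieldI, (0.3)–(0.4) p.176; Balaban1985Averaging, Prop. 2 (53) p.26] -/
theorem slotsT_one_ae_zero_on_rough_of_densitiesDescribed_theta13LiveOfRecord
    (hC : w.C = (datumOfRecord₁₃Sep F N (theta13LiveOfRecord F N) h).C) (hD : (leavesP w p).densitiesDescribed) (hg : 0 ≤ p.g0) (hK : 0 < p.K)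
    (s : SeqOfRecord F (theta13LiveOfRecord F N).ν (theta13LiveOfRecord F N).τ9.M (gOfRecord₁₃ F N (theta13LiveOfRecord F N) p) p.K 1)
    (hΩ : s.Ω 1 = ∅) {α₀ : ℝ} (hα : 0 < α₀)
    (hα3 : (143 * (((((F.P p.K).d + 4 : ℕ) : ℝ)) ^ 2 / 4) ^ 2) * α₀ ≤ 1 / 3)
    (hα2 : 2 * α₀ ≤ 2 * deltaSU (Fin N) / ((((F.P p.K).d + 4) * (F.P p.K).L : ℕ) : ℝ) ^ 2)
    (hαε : (theta13LiveOfRecord F N).s2.cR * epsOfRecord (theta13LiveOfRecord F N).ν (gOfRecord₁₃ F N (theta13LiveOfRecord F N) p) 0 ≤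
      α₀ * (F.P p.K).eta 1 ^ 2) :
    ∀ᵐ V1 ∂fieldMeasure (F.P p.K) 1 (SU N), ¬ PlaqSmall (2 * α₀ * (((F.P p.K).L : ℝ) ^ 1 * (F.P p.K).eta 1) ^ 2) V1 →
      slotsTOfRecord F N (theta13LiveOfRecord F N).ν (theta13LiveOfRecord F N).τ9 (EOfRecord₁₃ F N (theta13LiveOfRecord F N))
        (wOfRecord₉ F N (theta13LiveOfRecord F N).toStage9Params) (theta13LiveOfRecord F N).ppSel p
        (gOfRecord₁₃ F N (theta13LiveOfRecord F N) p) 1 s V1 = 0 :=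
  slotsT_one_ae_zero_on_rough_of_sLaw₁₃_one_theta13LiveOfRecord F N p hg hK s hΩ
    ((densitiesDescribed_leavesP_iff_sLaw₁₃_all_sep F N (theta13LiveOfRecord F N) p w h hC).1 hD 1 hK) hα hα3 hα2 hαε

/-- **★★ … AND SO DOES A NON-VACUOUS N11 CONJUNCT `Dag.B14_main (leavesP w p)` THERE** (in-edge leaves `b7 … b11`, small-field implication, flow control and the
interval hypothesis read TRUE; the `rOperation` antecedent is this seat's closed theorem `…LiveRstep.rOperation_leavesP_theta13LiveOfRecord`): K1⁗'s rung-1 conjunct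
at the witness of record forces def-T's all-large-field pre-𝐑 slot to vanish a.e. on the rough coarse fields of every run with `0 ≤ g₀`, `0 < K`.
[cite: Balaban1988Convergent, Thm 1 p.262, Theorem p.245, p.244, (3.25) p.270, (2.10) p.256, (3.16) p.268; Balaban1989LargeFieldI, (0.3)–(0.4) p.176; Balaban1985Averaging, Prop. 2 (53) p.26] -/
theorem slotsT_one_ae_zero_on_rough_of_b14_main_theta13LiveOfRecord
    (hC : w.C = (datumOfRecord₁₃Sep F N (theta13LiveOfRecord F N) h).C)
    (hup : w.up p = upOfRecord₅C F N ((theta13LiveOfRecord F N).toStage5₁₃ F N) p) (h14 : Dag.B14_main (leavesP w p))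
    (h7 : (leavesP w p).b7) (h8 : (leavesP w p).b8) (h9 : (leavesP w p).b9) (h10 : (leavesP w p).b10) (h11 : (leavesP w p).b11)
    (hsf : (leavesP w p).smallCouplings → (leavesP w p).smallFieldInductive) (hfc : (leavesP w p).smallCouplings → (leavesP w p).flowControl)
    (hsc : (leavesP w p).smallCouplings) (hg : 0 ≤ p.g0) (hK : 0 < p.K)
    (s : SeqOfRecord F (theta13LiveOfRecord F N).ν (theta13LiveOfRecord F N).τ9.M (gOfRecord₁₃ F N (theta13LiveOfRecord F N) p) p.K 1)
    (hΩ : s.Ω 1 = ∅) {α₀ : ℝ} (hα : 0 < α₀)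
    (hα3 : (143 * (((((F.P p.K).d + 4 : ℕ) : ℝ)) ^ 2 / 4) ^ 2) * α₀ ≤ 1 / 3)
    (hα2 : 2 * α₀ ≤ 2 * deltaSU (Fin N) / ((((F.P p.K).d + 4) * (F.P p.K).L : ℕ) : ℝ) ^ 2)
    (hαε : (theta13LiveOfRecord F N).s2.cR * epsOfRecord (theta13LiveOfRecord F N).ν (gOfRecord₁₃ F N (theta13LiveOfRecord F N) p) 0 ≤
      α₀ * (F.P p.K).eta 1 ^ 2) :
    ∀ᵐ V1 ∂fieldMeasure (F.P p.K) 1 (SU N), ¬ PlaqSmall (2 * α₀ * (((F.P p.K).L : ℝ) ^ 1 * (F.P p.K).eta 1) ^ 2) V1 →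
      slotsTOfRecord F N (theta13LiveOfRecord F N).ν (theta13LiveOfRecord F N).τ9 (EOfRecord₁₃ F N (theta13LiveOfRecord F N))
        (wOfRecord₉ F N (theta13LiveOfRecord F N).toStage9Params) (theta13LiveOfRecord F N).ppSel p
        (gOfRecord₁₃ F N (theta13LiveOfRecord F N) p) 1 s V1 = 0 :=
  slotsT_one_ae_zero_on_rough_of_densitiesDescribed_theta13LiveOfRecord F N p w h hC
    (h14 h7 h8 h9 h10 h11 hsf hfc (rOperation_leavesP_theta13LiveOfRecord F N p w hup) hsc) hg hK s hΩ hα hα3 hα2 hαε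

/-- **★★ THE NODE CONCLUSION AT THE WITNESS OF RECORD ⇒ NO AVERAGED MASS ON THE ROUGH ALL-(3.2)-LARGE COARSE FIELDS** (n11-d's reading (i), from
`densitiesDescribed`). [cite: Balaban1988Convergent, Thm 1 p.262, (3.25) p.270, (3.2) p.265, (2.12) p.256; Balaban1985Averaging, Prop. 2 (53) p.26, (10) p.19] -/
theorem avgDensity_ae_zero_on_rough_allLarge_of_densitiesDescribed_theta13LiveOfRecord
    (hC : w.C = (datumOfRecord₁₃Sep F N (theta13LiveOfRecord F N) h).C) (hD : (leavesP w p).densitiesDescribed) (hg : 0 ≤ p.g0) (hK : 0 < p.K)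
    (s : SeqOfRecord F (theta13LiveOfRecord F N).ν (theta13LiveOfRecord F N).τ9.M (gOfRecord₁₃ F N (theta13LiveOfRecord F N) p) p.K 1)
    (hΩ : s.Ω 1 = ∅) {α₀ : ℝ} (hα : 0 < α₀)
    (hα3 : (143 * (((((F.P p.K).d + 4 : ℕ) : ℝ)) ^ 2 / 4) ^ 2) * α₀ ≤ 1 / 3)
    (hα2 : 2 * α₀ ≤ 2 * deltaSU (Fin N) / ((((F.P p.K).d + 4) * (F.P p.K).L : ℕ) : ℝ) ^ 2)
    (hαε : (theta13LiveOfRecord F N).s2.cR * epsOfRecord (theta13LiveOfRecord F N).ν (gOfRecord₁₃ F N (theta13LiveOfRecord F N) p) 0 ≤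
      α₀ * (F.P p.K).eta 1 ^ 2) :
    ∀ᵐ V1 ∂fieldMeasure (F.P p.K) 1 (SU N), ¬ PlaqSmall (2 * α₀ * (((F.P p.K).L : ℝ) ^ 1 * (F.P p.K).eta 1) ^ 2) V1 →
      (∀ c : Iχ F (theta13LiveOfRecord F N).ν p (gOfRecord₁₃ F N (theta13LiveOfRecord F N) p) 0,
        chiFactor F N (theta13LiveOfRecord F N).ν p (gOfRecord₁₃ F N (theta13LiveOfRecord F N) p) 0 c V1 = 0) →
        (avgDensity (avOfRecord F N p.K 0).avg V1 : ℝ) = 0 :=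
  avgDensity_ae_zero_on_rough_allLarge_of_sLaw₁₃_one_theta13LiveOfRecord F N p hg hK s hΩ
    ((densitiesDescribed_leavesP_iff_sLaw₁₃_all_sep F N (theta13LiveOfRecord F N) p w h hC).1 hD 1 hK) hα hα3 hα2 hαε

/-- **★★ THE NODE CONCLUSION AT THE WITNESS OF RECORD ⇒ NO CUBE-ROUGH FINE FIELD ON THE FIBRES OF THE ROUGH ALL-(3.2)-SMALL COARSE FIELDS** (n11-d's reading (ii),
from `densitiesDescribed`). [cite: Balaban1988Convergent, Thm 1 p.262, (3.25) p.270, (3.2)–(3.3) p.265, (2.12) p.256; Balaban1985Averaging, Prop. 2 (53) p.26, (10) p.19] -/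
theorem avgDensity_zero_or_avgKernel_cubeRough_zero_ae_of_densitiesDescribed_theta13LiveOfRecord
    (hC : w.C = (datumOfRecord₁₃Sep F N (theta13LiveOfRecord F N) h).C) (hD : (leavesP w p).densitiesDescribed) (hg : 0 ≤ p.g0) (hK : 0 < p.K)
    (s : SeqOfRecord F (theta13LiveOfRecord F N).ν (theta13LiveOfRecord F N).τ9.M (gOfRecord₁₃ F N (theta13LiveOfRecord F N) p) p.K 1)
    (hΩ : s.Ω 1 = ∅) {α₀ : ℝ} (hα : 0 < α₀)
    (hα3 : (143 * (((((F.P p.K).d + 4 : ℕ) : ℝ)) ^ 2 / 4) ^ 2) * α₀ ≤ 1 / 3)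
    (hα2 : 2 * α₀ ≤ 2 * deltaSU (Fin N) / ((((F.P p.K).d + 4) * (F.P p.K).L : ℕ) : ℝ) ^ 2)
    (hαε : (theta13LiveOfRecord F N).s2.cR * epsOfRecord (theta13LiveOfRecord F N).ν (gOfRecord₁₃ F N (theta13LiveOfRecord F N) p) 0 ≤
      α₀ * (F.P p.K).eta 1 ^ 2)
    {R : Set (GaugeField (F.P p.K) 0 (SU N))} (hRm : MeasurableSet R)
    (hR : ∀ U ∈ R, ∀ c : Iχ F (theta13LiveOfRecord F N).ν p (gOfRecord₁₃ F N (theta13LiveOfRecord F N) p) 0,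
      ∃ q ∈ plaqInside (cubeEnl (F.P p.K) (sideχ F (theta13LiveOfRecord F N).ν p (gOfRecord₁₃ F N (theta13LiveOfRecord F N) p) 0) c 1),
        epsOfRecord (theta13LiveOfRecord F N).ν (gOfRecord₁₃ F N (theta13LiveOfRecord F N) p) 1 * (F.P p.K).eta 1 ^ 2 +
            4 * (2 * deltaOfRecord (theta13LiveOfRecord F N).ν (gOfRecord₁₃ F N (theta13LiveOfRecord F N) p) 0 (theta13LiveOfRecord F N).A₁) ≤
          dist1 (plaqHol U q)) :
    ∀ᵐ V1 ∂fieldMeasure (F.P p.K) 1 (SU N), ¬ PlaqSmall (2 * α₀ * (((F.P p.K).L : ℝ) ^ 1 * (F.P p.K).eta 1) ^ 2) V1 →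
      (∀ c : Iχ F (theta13LiveOfRecord F N).ν p (gOfRecord₁₃ F N (theta13LiveOfRecord F N) p) 0,
        chiFactor F N (theta13LiveOfRecord F N).ν p (gOfRecord₁₃ F N (theta13LiveOfRecord F N) p) 0 c V1 = 1) →
        (avgDensity (avOfRecord F N p.K 0).avg V1 : ℝ) = 0 ∨ avgKernel (avOfRecord F N p.K 0).avg V1 R = 0 :=
  avgDensity_zero_or_avgKernel_cubeRough_zero_ae_of_sLaw₁₃_one_theta13LiveOfRecord F N p hg hK s hΩ
    ((densitiesDescribed_leavesP_iff_sLaw₁₃_all_sep F N (theta13LiveOfRecord F N) p w h hC).1 hD 1 hK) hα hα3 hα2 hαε hRm hR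

end NodeFaces

/-! ## §5. THE UNIT-BRANCH FACE at a live selector with `εreg` in [B7] Prop. 2's range: `SLaw₁₃ θ p 1` ⇒ `dU{U cube-rough, Ū cornered-cube-rough} = 0` -/

section UnitBranchFace

variable (θ : Stage13Params F N) (p : B12.RunParams)

/-- **★★ AT THE LIVE SELECTOR OF A `θ` CARRYING K0b's RESIDUALS WITH `εreg` IN [B7] Prop. 2's RANGE, THE §2 FORM OF `ρ₁` MAKES THE DOUBLY-ROUGH EVENT HAAR-NULL**
(seat dag-n11-d's `…UnitBranch.fieldMeasure_cubeRough_inter_preimage_eq_zero_of_tLaw₁₃_of_Zt_eq_ZtOfRecord` with `SLaw₁₃ θ p 1` for `TLaw₁₃ θ p 0`: their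
`…_of_slotsT_ae_zero` face fed by §2 at `α₀ := εreg`; hypotheses theirs verbatim otherwise — `0 < sideD, sideχ`, `0 < K`, `1 ≤ m + K`, `0 < εreg`,
`C₀(d)εreg ≤ ⅓`, `2εreg ≤ 2δ_N∕((d+4)L)²`, `1 ≤ M₁`, grid `3·L·M₁ ≤ sideχ`, `0 < ε₁η₁²`, junction at both scales, `1 ≤ M`): for every measurable set `R` of cube-rough old
fields, `dU{U ∈ R, Ū has a 2εreg-rough plaquette cornered in pts 1 (□′^{∼3}) for every χ₁-cube □′} = 0`.  With the Haar-positivity of that event (n11-d's announced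
`fieldMeasure_cubeRough_inter_preimage_pos`) this reads `¬ SLaw₁₃ θ p 1` at every such live witness on every run with `0 < K`.
[cite: Balaban1988Convergent, Thm 1 p.262, (2.18) p.257, (3.25) p.270, (2.10)–(2.12) p.256, (3.2)–(3.3) p.265, (3.16) p.268; Balaban1989LargeFieldI, (0.3)–(0.4) p.176; Balaban1985Averaging, Prop. 2 (53)–(54) p.26] -/
theorem fieldMeasure_cubeRough_inter_preimage_eq_zero_of_sLaw₁₃_one_of_liveSel (hres : θ.HasResidualsOfRecord F N)
    (hsel : θ.ppSel = ppSelLiveOfRecord F N θ.ν θ.τ9 (EOfRecord₁₃ F N θ) (wOfRecord₉ F N θ.toStage9Params))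
    (hD : 0 < sideD F θ.ν θ.τ9.M p (gOfRecord₁₃ F N θ p) 0) (hχ : 0 < sideχ F θ.ν p (gOfRecord₁₃ F N θ p) 0) (hK : 0 < p.K)
    (hmK : 1 ≤ (F.P p.K).m + (F.P p.K).K) (hε : 0 < θ.ν.εreg)
    (hε3 : (143 * (((((F.P p.K).d + 4 : ℕ) : ℝ)) ^ 2 / 4) ^ 2) * θ.ν.εreg ≤ 1 / 3)
    (hε2 : 2 * θ.ν.εreg ≤ 2 * deltaSU (Fin N) / ((((F.P p.K).d + 4) * (F.P p.K).L : ℕ) : ℝ) ^ 2)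
    (hM : 1 ≤ θ.ν.M₁) (h3 : 3 * side (F.P p.K).L θ.ν.M₁ 1 ≤ sideχ F θ.ν p (gOfRecord₁₃ F N θ p) 0)
    (hε₁ : 0 < epsOfRecord θ.ν (gOfRecord₁₃ F N θ p) 1 * (F.P p.K).eta 1 ^ 2)
    (hc : θ.s2.cR * epsOfRecord θ.ν (gOfRecord₁₃ F N θ p) 0 ≤ θ.ν.εreg * (F.P p.K).eta 0 ^ 2) (hMτ : 1 ≤ θ.τ9.M)
    (hαε : θ.s2.cR * epsOfRecord θ.ν (gOfRecord₁₃ F N θ p) 0 ≤ θ.ν.εreg * (F.P p.K).eta 1 ^ 2)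
    (s : SeqOfRecord F θ.ν θ.τ9.M (gOfRecord₁₃ F N θ p) p.K 1) (hΩ : s.Ω 1 = ∅) (hS : SLaw₁₃ F N θ p 1)
    {R : Set (GaugeField (F.P p.K) 0 (SU N))} (hRm : MeasurableSet R)
    (hR : ∀ U ∈ R, ∀ c : Iχ F θ.ν p (gOfRecord₁₃ F N θ p) 0,
      ∃ q ∈ plaqInside (cubeEnl (F.P p.K) (sideχ F θ.ν p (gOfRecord₁₃ F N θ p) 0) c 1),
        epsOfRecord θ.ν (gOfRecord₁₃ F N θ p) 1 * (F.P p.K).eta 1 ^ 2 + 4 * (2 * deltaOfRecord θ.ν (gOfRecord₁₃ F N θ p) 0 θ.A₁) ≤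
          dist1 (plaqHol U q)) :
    fieldMeasure (F.P p.K) 0 (SU N) (R ∩ (avOfRecord F N p.K 0).avg ⁻¹'
      {V1 : GaugeField (F.P p.K) 1 (SU N) | ∀ c : Iχ F θ.ν p (gOfRecord₁₃ F N θ p) 0, ∃ q : Plaq (F.P p.K) 1,
        q.src ∈ pts 1 (cubeEnl (F.P p.K) (sideχ F θ.ν p (gOfRecord₁₃ F N θ p) 0) c 3) ∧
          q.src.shift q.μ ∈ pts 1 (cubeEnl (F.P p.K) (sideχ F θ.ν p (gOfRecord₁₃ F N θ p) 0) c 3) ∧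
          q.src.shift q.ν ∈ pts 1 (cubeEnl (F.P p.K) (sideχ F θ.ν p (gOfRecord₁₃ F N θ p) 0) c 3) ∧
          2 * θ.ν.εreg ≤ dist1 (plaqHol V1 q)}) = 0 :=
  fieldMeasure_cubeRough_inter_preimage_eq_zero_of_slotsT_ae_zero θ p hres.zetaUnity hD hχ hK hmK hε hε3 hε2 hM h3 hε₁ s hΩ
    (slotsT_one_ae_zero_on_rough_of_sLaw₁₃_one_of_liveSel θ p hres hsel hc hMτ hK s hΩ hS hε hε3 hε2 hαε) hRm hR

end UnitBranchFace

end Summit.QuantumFields.YangMills.Theorems.BalabanUVNodesN11LiveRecordRoughFibre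

end
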